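import Summits.QuantumFields.YangMills.Theorems.BalabanUVNodesN15CurvedGluingLocalGauges
import Summits.QuantumFields.YangMills.Theorems.BalabanUVNodesN15CurvedGluingCubeDressedGeneralGaugeUN
import Summits.QuantumFields.YangMills.Theorems.BalabanUVNodesN15CurvedGluingSpeciesCommutatorDefect
import Summits.QuantumFields.YangMills.Theorems.BalabanUVNodesN15CurvedGluingCubeDressedGeneral
import HarnessLib

/-!
# Route «BalabanUVNodes» (cluster K4 «SpineRates»), Track-A DAG node N15 = NE2, BACKGROUND LAYER — GLUING ACROSS PER-CUBE GAUGES AT THE GAUGE GROUP OF RECORD `U(N)`, AND THE LOCAL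
# OPERATOR READ AS BAŁABAN's COVARIANT LAPLACIAN AT THE GAUGE-TRANSFORMED BACKGROUND: `M_W(Δ_R + P)M_{Wᵀ} = Δ_{R^W} + P^W` (so the cube's rows are rows of the species device at the
# small background `R^{W_□}`), and `…CurvedGluingLocalGauges` with `W_□(x) = coordMat e (Ad_{u_□(x)})`, `u_□` unitary site fields — no orthogonality hypothesis left

Cell `pub-ymgap`, seat `pub-ymgap-dag-n15-w2` (WIDTH SEAT 2∕3 on node N15, director-ym №197 ∕ HUMAN RULING D-0149), g5, ninth piece (bus CLAIM-9) — the `U(N)` edition of (o1).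
`bears_on: R4∕N15 · K3⁸ SpineGivenEndpointR13SepCoPHV (stmt-QuantumFields-27366)`.  Filed `--kind proof --supports stmt-QuantumFields-27366 --as helper` — COUNT-NEUTRAL.  Theorems only;
0 `def`, 0 `sorry`.  Imports BY NAME this seat's `…CurvedGluingLocalGauges` (`hasMaj_glued_of_localGauges`, `glued_inverse_of_localGauges`) and g4 `…DressedGeneralGaugeUN` (through it g2
`uN_siteGauge_orthogonal`; g4 `gaugeConj_add`; n15-w3 file 3 `covLapM_trGaugeAct`, `gaugePair_trGaugeActFwd`, `trGaugeActFwd`); nothing in the tree is modified, no landed name re-declared.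

WHY.  `…CurvedGluingLocalGauges` glues per-cube parametrices of the LOCAL operators `Δ^{W_k} = M_{W_k}ΔM_{W_kᵀ}`.  For the global operator of the background layer, `Δ = Δ_R + P`
(`Δ_R = covLapM τ η (gaugePair τ R)`, FILE 28's (3.50) at the background transporters `R`, plus any remainder `P`), (3.34) says what the local operator IS: `Δ^{W} = Δ_{R^W} + P^W` with
`R^W = trGaugeActFwd τ W R` the gauge-transformed background — on a cube whose (3.35) gauge makes `R^{W_□}` small, exactly the operator the species device (n15-w3 files 1–45, this seat's
FILES 1–6) dresses around `U ≡ 1`.  And at `G = U(N)` the per-cube gauges are `W_□(x) = coordMat e (Ad_{u_□(x)})` for unitary site fields `u_□`, orthogonal on both sides (g2).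
* §1 ★★ `localOp_eq_covLapM_trGaugeActFwd_add` (`M_W(Δ_R + P)M_{Wᵀ} = Δ_{R^W} + M_WPM_{Wᵀ}`, `WWᵀ = 1`), `localOp_eq_covLapM_trGaugeActFwd` (`P = 0`);
* §2 ★★★ `uN_hasMaj_glued_of_localGauges`, ★★★ `uN_glued_inverse_of_localGauges` — FILE 7's two theorems with `W_k(x) = coordMat e (Ad_{u_k(x)})`, `u_k(x)ᴴu_k(x) = 1`, NO orthogonality
  hypothesis (g2 `uN_siteGauge_orthogonal`).

HONEST FRAMING ∕ LIMITS.  Bookkeeping ((3.34)–(3.35) p. 396, (3.50) p. 400, (3.87) p. 409 = SHAPES ∕ MECHANISM); the unitary site fields `u_□` (the (3.35) gauges), the local parametrices and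
their rows are HYPOTHESES; one grid; cost `|κ|²`.  Nothing of [B5]∕[B6]∕[B9] asserted; NE2⁺ NOT PRINTED, NOT proved; N15 NOT discharged; K3⁸ OPEN, skeleton v6 untouched; counts of record
UNMOVED (typed 28∕28 · discharged 5∕27 · A 5∕28); one finite 𝕋⁴ at fixed ε — NOT ℝ⁴ ∕ OS ∕ mass gap ∕ Clay; R4 closes the conditional finite-𝕋⁴ rung `BalabanLadder.UV` only.  Restate-immune.
-/

set_option autoImplicit false

noncomputable section
open scoped BigOperators Matrix Matrix.Norms.Frobenius

namespace Summit.QuantumFields.YangMills.BalabanUVNodes.N15.CurvedSpecies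

open Literature.MathematicalPhysics.QuantumFieldTheory.Balaban1983to89
open Literature.MathematicalPhysics.QuantumFieldTheory.Balaban1983to89.B11SectG (BlockNorm HasMaj RowSum)
open Literature.MathematicalPhysics.QuantumFieldTheory.Balaban1983to89.B6RandomWalk (Triangle254)
open Literature.MathematicalPhysics.QuantumFieldTheory.Balaban1983to89.B6Prop26Gluing (mulOp ind)
open Summit.QuantumFields.YangMills.BalabanUVNodes.N15.MatrixSpecies (mmulOp liftBlk coordMat)
open Summit.QuantumFields.YangMills.BalabanUVNodes.N15.MatrixSpecies (liftEquiv)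
open Summit.QuantumFields.YangMills.BalabanUVNodes.N15.BackgroundLayer (covLapM tCoefA tCoefC unstackM stack fgrad bgrad speciesOpM)
open Summit.QuantumFields.YangMills.BalabanUVNodes.N15.Gluing (lapOp)
open Summit.QuantumFields.YangMills.BalabanUVNodes.N15.Gluing (parametrix remainder commOp glueInv)
open Literature.Barriers.QuantumFields (traceForm)

/-! ## §1 The local operator IS the covariant Laplacian at the gauge-transformed background (plus the conjugated remainder) -/

section LocalOp

variable {X ι J : Type} [Fintype ι] [DecidableEq ι] [Fintype J] (η : ℝ) (τ : J → X ≃ X) (W : X → Matrix ι ι ℝ) (R : J → X → Matrix ι ι ℝ)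

/-- ★★ **(3.34) FOR THE LOCAL OPERATOR OF `…CurvedGluingLocalGauges`**: `M_W∘(Δ_R + P)∘M_{Wᵀ} = Δ_{R^W} + M_W∘P∘M_{Wᵀ}` (`WWᵀ = 1`; `Δ_R = covLapM τ η (gaugePair τ R)`, `R^W = trGaugeActFwd τ W R`)
— the operator whose cube parametrices FILE 7 asks for is Bałaban's covariant Laplacian at the gauge-transformed background plus the conjugated remainder; on a (3.35) cube `R^{W_□}` is the
small field the species device dresses around `U ≡ 1`. [cite: Balaban1985BackgroundPropagators, (3.34)–(3.35) p.396, (3.50) p.400] -/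
theorem localOp_eq_covLapM_trGaugeActFwd_add (hW : ∀ x, W x * (W x)ᵀ = 1) (P : (X × ι → ℝ) →ₗ[ℝ] (X × ι → ℝ)) :
    mmulOp W ∘ₗ (covLapM τ η (gaugePair τ R) + P) ∘ₗ mmulOp (fun x => (W x)ᵀ) =
      covLapM τ η (gaugePair τ (trGaugeActFwd τ W R)) + mmulOp W ∘ₗ P ∘ₗ mmulOp (fun x => (W x)ᵀ) := by
  rw [gaugeConj_add, gaugePair_trGaugeActFwd, covLapM_trGaugeAct η τ W hW]

/-- The remainder-free case: `M_W∘Δ_R∘M_{Wᵀ} = Δ_{R^W}` (n15-w3 `covLapM_trGaugeAct` read through `gaugePair_trGaugeActFwd`). [cite: Balaban1985BackgroundPropagators, (3.34) p.396, (3.50) p.400] -/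
theorem localOp_eq_covLapM_trGaugeActFwd (hW : ∀ x, W x * (W x)ᵀ = 1) :
    mmulOp W ∘ₗ covLapM τ η (gaugePair τ R) ∘ₗ mmulOp (fun x => (W x)ᵀ) = covLapM τ η (gaugePair τ (trGaugeActFwd τ W R)) := by
  rw [gaugePair_trGaugeActFwd, covLapM_trGaugeAct η τ W hW]

/-- ★★★ **THE LOCAL OPERATOR IN THE SPECIES DEVICE's FORMAT**: `M_W(Δ_R + P)M_{Wᵀ} = lapOp η⁻¹ (liftEquiv∘τ) 0 + M_WPM_{Wᵀ} − unstackM (tCoefC η Rp^W) (tCoefA η Rp^W)∘jet_{η⁻¹}`,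
`Rp^W = gaugePair τ (trGaugeActFwd τ W R)` (FILE 28 (3.53) via n15-w3 file 13 `covLapM_eq_lapOp` + file 23 `speciesOpM_eq_unstackM_comp_jet`) — EXACTLY the shape `Σ∇*∇ + W₀ + N_L − V̂∘jet` of
dag-n15-w3 files 32∕44∕45 (`W₀ = 0`, `N_L = M_WPM_{Wᵀ}`, `V̂ = unstackM (tCoefC …) (tCoefA …)` = the species of the gauge-transformed background, whose letters this seat's FILES 1–6 supply when
`R^W` is (3.35)-small): the per-cube LOCAL parametrices FILE 7 asks for are the dressed cubes of that device. [cite: Balaban1985BackgroundPropagators, (3.34)–(3.35) p.396, (3.50)–(3.53) p.400, (3.87) p.409] -/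
theorem localOp_species_form [Fintype X] [DecidableEq X] [DecidableEq J] (hW : ∀ x, W x * (W x)ᵀ = 1) (P : (X × ι → ℝ) →ₗ[ℝ] (X × ι → ℝ)) :
    mmulOp W ∘ₗ (covLapM τ η (gaugePair τ R) + P) ∘ₗ mmulOp (fun x => (W x)ᵀ) =
      lapOp η⁻¹ (fun μ => liftEquiv (τ μ) ι) 0 + mmulOp W ∘ₗ P ∘ₗ mmulOp (fun x => (W x)ᵀ) -
        unstackM (tCoefC η (gaugePair τ (trGaugeActFwd τ W R))) (tCoefA η (gaugePair τ (trGaugeActFwd τ W R))) ∘ₗ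
          stack LinearMap.id (fun j : J ⊕ J => Sum.elim (fun μ => fgrad η⁻¹ (liftEquiv (τ μ) ι)) (fun μ => bgrad η⁻¹ (liftEquiv (τ μ) ι)) j) := by
  rw [localOp_eq_covLapM_trGaugeActFwd_add η τ W R hW, covLapM_eq_lapOp, speciesOpM_eq_unstackM_comp_jet]
  simp only [lapOp, add_zero]
  abel

end LocalOp

/-! ## §2 `U(N)` per-cube gauges: FILE 7 with the orthogonality discharged -/

section UN

variable {n : Type} [Fintype n] [DecidableEq n] {κ : Type} [Fintype κ] [DecidableEq κ] (e : Matrix n n ℂ ≃L[ℝ] (κ → ℝ))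
variable {X : Type} [Fintype X] [DecidableEq X] {K : Type} [Fintype K] {g : B6.Geometry} (blk : X → g.Site) (S : K → Set g.Site) (u : K → X → Matrix n n ℂ)
  (Δ : (X × κ → ℝ) →ₗ[ℝ] (X × κ → ℝ)) (hX χX : K → X → ℝ) (G' E' : K → (X × κ → ℝ) →ₗ[ℝ] (X × κ → ℝ)) {σ cr : ℝ}

/-- ★★★ **THE GLUED OPERATOR FROM `U(N)` PER-CUBE GAUGES DECAYS** — `hasMaj_glued_of_localGauges` with `W_k(x) = coordMat e (Ad_{u_k(x)})`, `u_k(x)ᴴu_k(x) = 1`, trace-form-orthonormal `e`: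
NO orthogonality hypothesis. [cite: Balaban1985BackgroundPropagators, (3.34)–(3.35) p.396, (3.87) p.409 (shapes ∕ mechanism); Balaban1984PropagatorsII, (2.133)–(2.136) p.247] -/
theorem uN_hasMaj_glued_of_localGauges (he : ∀ A B : Matrix n n ℂ, traceForm A B = e A ⬝ᵥ e B) (hu : ∀ k x, (u k x)ᴴ * u k x = 1) (htri : Triangle254 g)
    (hd : ∀ a b : g.Site, 0 ≤ g.dist a b) (hd0 : ∀ y : g.Site, g.dist y y = 0) (hrow : RowSum g σ cr) (hσ : 0 ≤ σ) {β θ₀ ε δ Nov : ℝ} (hβ : 0 ≤ β) (hθ : 0 ≤ θ₀) (hε : 0 ≤ ε)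
    (hNov : 0 ≤ Nov) (hσδ : 2 * σ ≤ δ)
    (hcut : ∀ k, mulOp (fun p : X × κ => hX k p.1) ∘ₗ mulOp (fun p : X × κ => χX k p.1) = mulOp (fun p : X × κ => hX k p.1)) (hh : ∀ k p, |(fun p : X × κ => hX k p.1) p| ≤ 1)
    (hN : ∀ a, ∑ k, ind (S k) a ≤ Nov)
    (hGc' : ∀ k, HasMaj (BlockNorm.ofBlocks g (liftBlk blk κ)) (BlockNorm.ofBlocks g (liftBlk blk κ)) (mulOp (fun p : X × κ => χX k p.1) ∘ₗ G' k)
      (fun y y' => ind (S k) y * ind (S k) y' * (β * Real.exp (-(δ * g.dist y y')))))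
    (hK' : ∀ k, HasMaj (BlockNorm.ofBlocks g (liftBlk blk κ)) (BlockNorm.ofBlocks g (liftBlk blk κ))
      (commOp (mmulOp (fun x => coordMat e (ContinuousLinearMap.mulLeftRight ℝ (Matrix n n ℂ) (u k x) (u k x)ᴴ)) ∘ₗ Δ ∘ₗ
          mmulOp (fun x => (coordMat e (ContinuousLinearMap.mulLeftRight ℝ (Matrix n n ℂ) (u k x) (u k x)ᴴ))ᵀ)) (fun p : X × κ => hX k p.1) ∘ₗ G' k)
      (fun y y' => ind (S k) y' * (θ₀ * Real.exp (-(δ * g.dist y y')))))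
    (hE' : ∀ k, HasMaj (BlockNorm.ofBlocks g (liftBlk blk κ)) (BlockNorm.ofBlocks g (liftBlk blk κ)) (E' k) (fun y y' => ind (S k) y * (ε * Real.exp (-(δ * g.dist y y')))))
    (hq : Nov * ((Fintype.card κ : ℝ) ^ 2 * θ₀ + (Fintype.card κ : ℝ) ^ 2 * ε) * cr < 1) :
    HasMaj (BlockNorm.ofBlocks g (liftBlk blk κ)) (BlockNorm.ofBlocks g (liftBlk blk κ))
      (glueInv (parametrix (fun k => fun p : X × κ => hX k p.1)
          (fun k => mmulOp (fun x => (coordMat e (ContinuousLinearMap.mulLeftRight ℝ (Matrix n n ℂ) (u k x) (u k x)ᴴ))ᵀ) ∘ₗ G' k ∘ₗ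
            mmulOp (fun x => coordMat e (ContinuousLinearMap.mulLeftRight ℝ (Matrix n n ℂ) (u k x) (u k x)ᴴ))))
        (remainder Δ (fun k => fun p : X × κ => hX k p.1)
            (fun k => mmulOp (fun x => (coordMat e (ContinuousLinearMap.mulLeftRight ℝ (Matrix n n ℂ) (u k x) (u k x)ᴴ))ᵀ) ∘ₗ G' k ∘ₗ
              mmulOp (fun x => coordMat e (ContinuousLinearMap.mulLeftRight ℝ (Matrix n n ℂ) (u k x) (u k x)ᴴ))) -
          ∑ k, (mmulOp (fun x => (coordMat e (ContinuousLinearMap.mulLeftRight ℝ (Matrix n n ℂ) (u k x) (u k x)ᴴ))ᵀ) ∘ₗ E' k ∘ₗ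
            mmulOp (fun x => coordMat e (ContinuousLinearMap.mulLeftRight ℝ (Matrix n n ℂ) (u k x) (u k x)ᴴ))) ∘ₗ mulOp (fun p : X × κ => hX k p.1)))
      (fun y y' => Nov * ((Fintype.card κ : ℝ) ^ 2 * β) * (1 - Nov * ((Fintype.card κ : ℝ) ^ 2 * θ₀ + (Fintype.card κ : ℝ) ^ 2 * ε) * cr)⁻¹ * cr *
        Real.exp (-((δ - σ) * g.dist y y'))) :=
  hasMaj_glued_of_localGauges blk S (fun k x => coordMat e (ContinuousLinearMap.mulLeftRight ℝ (Matrix n n ℂ) (u k x) (u k x)ᴴ)) Δ hX χX G' E' htri hd hd0 hrow hσ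
    (fun k x => (uN_siteGauge_orthogonal e (u k) he (hu k) x).1) (fun k x => (uN_siteGauge_orthogonal e (u k) he (hu k) x).2) hβ hθ hε hNov hσδ hcut hh hN hGc' hK' hE' hq

/-- ★★★ **… AND INVERTS THE GLOBAL OPERATOR** — `glued_inverse_of_localGauges` with `U(N)` per-cube gauges, NO orthogonality hypothesis.
[cite: Balaban1985BackgroundPropagators, (3.34)–(3.35) p.396, (3.87) p.409, Cor. 3.6 p.408 (mechanism); Balaban1984PropagatorsII, (2.91) p.239, (2.135)–(2.136) p.247] -/
theorem uN_glued_inverse_of_localGauges (he : ∀ A B : Matrix n n ℂ, traceForm A B = e A ⬝ᵥ e B) (hu : ∀ k x, (u k x)ᴴ * u k x = 1) (hd : ∀ a b : g.Site, 0 ≤ g.dist a b)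
    (hrow : RowSum g σ cr) {θ₀ ε δ Nov : ℝ} (hθ : 0 ≤ θ₀) (hε : 0 ≤ ε) (hNov : 0 ≤ Nov) (hσδ : σ ≤ δ) (h236 : ∀ p : X × κ, ∑ k, (fun p : X × κ => hX k p.1) p ^ 2 = 1)
    (hh : ∀ k p, |(fun p : X × κ => hX k p.1) p| ≤ 1) (hN : ∀ a, ∑ k, ind (S k) a ≤ Nov)
    (hloc' : ∀ k, mulOp (fun p : X × κ => hX k p.1) ∘ₗ (mmulOp (fun x => coordMat e (ContinuousLinearMap.mulLeftRight ℝ (Matrix n n ℂ) (u k x) (u k x)ᴴ)) ∘ₗ Δ ∘ₗ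
        mmulOp (fun x => (coordMat e (ContinuousLinearMap.mulLeftRight ℝ (Matrix n n ℂ) (u k x) (u k x)ᴴ))ᵀ)) ∘ₗ G' k = mulOp (fun p : X × κ => hX k p.1) + E' k)
    (hK' : ∀ k, HasMaj (BlockNorm.ofBlocks g (liftBlk blk κ)) (BlockNorm.ofBlocks g (liftBlk blk κ))
      (commOp (mmulOp (fun x => coordMat e (ContinuousLinearMap.mulLeftRight ℝ (Matrix n n ℂ) (u k x) (u k x)ᴴ)) ∘ₗ Δ ∘ₗ
          mmulOp (fun x => (coordMat e (ContinuousLinearMap.mulLeftRight ℝ (Matrix n n ℂ) (u k x) (u k x)ᴴ))ᵀ)) (fun p : X × κ => hX k p.1) ∘ₗ G' k)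
      (fun y y' => ind (S k) y' * (θ₀ * Real.exp (-(δ * g.dist y y')))))
    (hE' : ∀ k, HasMaj (BlockNorm.ofBlocks g (liftBlk blk κ)) (BlockNorm.ofBlocks g (liftBlk blk κ)) (E' k) (fun y y' => ind (S k) y * (ε * Real.exp (-(δ * g.dist y y')))))
    (hq : Nov * ((Fintype.card κ : ℝ) ^ 2 * θ₀ + (Fintype.card κ : ℝ) ^ 2 * ε) * cr < 1) :
    glueInv (parametrix (fun k => fun p : X × κ => hX k p.1)
          (fun k => mmulOp (fun x => (coordMat e (ContinuousLinearMap.mulLeftRight ℝ (Matrix n n ℂ) (u k x) (u k x)ᴴ))ᵀ) ∘ₗ G' k ∘ₗ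
            mmulOp (fun x => coordMat e (ContinuousLinearMap.mulLeftRight ℝ (Matrix n n ℂ) (u k x) (u k x)ᴴ))))
        (remainder Δ (fun k => fun p : X × κ => hX k p.1)
            (fun k => mmulOp (fun x => (coordMat e (ContinuousLinearMap.mulLeftRight ℝ (Matrix n n ℂ) (u k x) (u k x)ᴴ))ᵀ) ∘ₗ G' k ∘ₗ
              mmulOp (fun x => coordMat e (ContinuousLinearMap.mulLeftRight ℝ (Matrix n n ℂ) (u k x) (u k x)ᴴ))) -
          ∑ k, (mmulOp (fun x => (coordMat e (ContinuousLinearMap.mulLeftRight ℝ (Matrix n n ℂ) (u k x) (u k x)ᴴ))ᵀ) ∘ₗ E' k ∘ₗ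
            mmulOp (fun x => coordMat e (ContinuousLinearMap.mulLeftRight ℝ (Matrix n n ℂ) (u k x) (u k x)ᴴ))) ∘ₗ mulOp (fun p : X × κ => hX k p.1)) ∘ₗ Δ = LinearMap.id ∧
      Δ ∘ₗ glueInv (parametrix (fun k => fun p : X × κ => hX k p.1)
          (fun k => mmulOp (fun x => (coordMat e (ContinuousLinearMap.mulLeftRight ℝ (Matrix n n ℂ) (u k x) (u k x)ᴴ))ᵀ) ∘ₗ G' k ∘ₗ
            mmulOp (fun x => coordMat e (ContinuousLinearMap.mulLeftRight ℝ (Matrix n n ℂ) (u k x) (u k x)ᴴ))))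
        (remainder Δ (fun k => fun p : X × κ => hX k p.1)
            (fun k => mmulOp (fun x => (coordMat e (ContinuousLinearMap.mulLeftRight ℝ (Matrix n n ℂ) (u k x) (u k x)ᴴ))ᵀ) ∘ₗ G' k ∘ₗ
              mmulOp (fun x => coordMat e (ContinuousLinearMap.mulLeftRight ℝ (Matrix n n ℂ) (u k x) (u k x)ᴴ))) -
          ∑ k, (mmulOp (fun x => (coordMat e (ContinuousLinearMap.mulLeftRight ℝ (Matrix n n ℂ) (u k x) (u k x)ᴴ))ᵀ) ∘ₗ E' k ∘ₗ
            mmulOp (fun x => coordMat e (ContinuousLinearMap.mulLeftRight ℝ (Matrix n n ℂ) (u k x) (u k x)ᴴ))) ∘ₗ mulOp (fun p : X × κ => hX k p.1)) = LinearMap.id :=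
  glued_inverse_of_localGauges blk S (fun k x => coordMat e (ContinuousLinearMap.mulLeftRight ℝ (Matrix n n ℂ) (u k x) (u k x)ᴴ)) Δ hX G' E' hd hrow
    (fun k x => (uN_siteGauge_orthogonal e (u k) he (hu k) x).1) (fun k x => (uN_siteGauge_orthogonal e (u k) he (hu k) x).2) hθ hε hNov hσδ h236 hh hN hloc' hK' hE' hq

end UN

end Summit.QuantumFields.YangMills.BalabanUVNodes.N15.CurvedSpecies

end
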